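import Summits.BirchSwinnertonDyer.BirchSwinnertonDyer.Theorems.ErratumRoadFiveFixedPartTriangularReduction
import Literature.NumberTheory.GaloisRepresentations.LocalUnramifiedCharactersDensityProofs
import Literature.NumberTheory.GaloisRepresentations.PadicUnitPowersProofs
import Literature.NumberTheory.GaloisRepresentations.AbsGaloisGroupCompact
import Mathlib.NumberTheory.Padics.RingHoms
import HarnessLib

/-!
# (FIX)† for a TWISTED ordinary frame: finitely many `σ₁`-fixed vectors as soon as BOTH diagonal characters are `≠ 1` at `σ₁`,
# and the local-Galois lemma that makes them so — a continuous character that is torsion on `P = ker κ₁ ∩ ker κ₂` and whose value at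
# one element `σ_K ∈ ker κ₂ ∖ P` separates exponents is `≠ 1` at EVERY `σ₁ ∈ ker κ₂ ∖ ker κ₁` (helper, `--supports stmt-BirchSwinnertonDyer-23253`)

Cell `bsd-stepL`, seat `bsd-stepL-imc-p1` (prover g25, 2026-08-28). Theorems only (no definition, no named fact, no `sorry`, no
instance, no notation). GENERIC INGREDIENTS of the kernel discharge of the stub (FIX)† = `stub_finiteFixedPartAnomalous_selfDual` of line
`erratum_chain`† of crux 23253 `ErratumThm23SigmaLeSelfDual` (the self-dual re-key of 25505; seat NOTES §FIX†), the twisted companion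
of imc-p1 g23's `FixReduction` ∕ `FixAssembly` (p645750 ∕ p648045). For the UNTWISTED module the quotient character `δ` of the ordinary
frame is unramified and `FixAssembly.finite_fixed_of_frame` kills the line `A⁺` with a torsion inertia element of `P`; for the SELF-DUAL
twist `A_g^† = A_g ⊗ ε^{1−k/2}` the diagonal characters are `χ^† = ε^{k/2}δ⁻¹`, `δ^† = ε^{1−k/2}δ`, on the anomalous corner `P` fixes a
whole line, and one needs instead `χ^†(σ₁) ≠ 1 ≠ δ^†(σ₁)` — which §3 derives from ONE element `σ_K` (in the application: Serre's local
symbol of `π̄/π`, tree `ZpExtension.exists_isFrobPow_mem_kerSubgroup_of_isAnticyclotomic_holds`) at which the character has a value of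
infinite order.

* §1 `finite_fixed_of_apply_sub_one_ne_zero` — triangular model `(χ e; 0 δ)` on `B × B`, `B[c]` finite for `c ≠ 0`:
  `χ(σ₁) − 1 ≠ 0` and `δ(σ₁) − 1 ≠ 0` ⟹ `{a | ρ σ₁ a = a}` finite (pure algebra).
* §2 `tendsto_pow_of_tendsto_natCast_padicInt_zero` — `‖u − 1‖ < 1` (ultrametric field with `‖p‖ < 1`) and `a_m → 0` in `ℤ_p` ⟹
  `u^{a_m} → 1` (converse of `PadicUnitPowers.tendsto_natCast_padicInt_zero_of_tendsto_pow`); `pow_eq_one_of_unramified_of_apply_eq_one` —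
  for UNRAMIFIED `ν : Γ_F → ℤ_p` with `ν(Frob) ≠ 0` and `δ : Γ_F → L` with `‖δ(Frob)^N − 1‖ < 1`: `ν(σ) = 0 ⟹ δ(σ)^N = 1` (density of
  `⟨Frob⟩·I_F`, companion of `IsNonarchimedeanLocalField.toAdd_eq_zero_of_unramified_of_apply_eq_one`);
  `unramified_apply_eq_one_of_apply_frob_eq_one` — an unramified `ν` with `ν(Frob) = 0` vanishes.
* §3 `apply_ne_one_of_pow_eq_one_of_ker` — TWO-COORDINATE EXPONENT SEPARATION: `Θ : Γ_F →* L` continuous, `κ₁, κ₂ : Γ_F → ℤ_p`,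
  `Θ^N = 1` on `P = ker κ₁ ∩ ker κ₂`, `σ_K ∈ ker κ₂ ∖ ker κ₁` with `Θ(σ_K)⁻¹` exponent-separating ⟹ `Θ(σ₁) ≠ 1` for every
  `σ₁ ∈ ker κ₂ ∖ ker κ₁` (compactness of `Γ_F`: a cluster point of `σ₁^{p^v}σ_K^{−n_m}`, `n_m → κ₁(σ₁)p^v/κ₁(σ_K)` in `ℤ_p`, lies in `P`).

HONEST FRAMING: generic lemmas; nothing about BSD for any pair; closes: none (T7).

## References
* [JetchevSkinnerWan2017] §3.3 Case 3(b), §3.4 Lemma 3.4.1 (arXiv:1512.06894 pp. 13–14) — the finiteness being repaired.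
* [SerreLocalFields1979] Ch. IV §2 Prop. 6, §3 Prop. 9 (principal units), §4 Cor. 2 to Prop. 16 (`⟨Frob⟩·I` dense).
* [Castella2018Erratum] §2 (p. 2: the self-dual Tate twist), Lemma 2.1.
-/

noncomputable section

-- D-0017: single-problem summit, the namespace repeats the problem name by design.
set_option linter.dupNamespace false
set_option autoImplicit false

open Filter Topology Field
open Literature.NumberTheory.GaloisRepresentations Literature.NumberTheory.GaloisRepresentations.IsNonarchimedeanLocalField

namespace Summit.BirchSwinnertonDyer.BirchSwinnertonDyer.Theorems.ErratumThm23TwoVariable.FixTwist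

/-! ## §1 Finitely many `σ₁`-fixed vectors in a triangular model with both diagonal entries `≠ 1` -/

/-- **Finitely many fixed vectors of ONE triangular operator whose diagonal entries are both `≠ 1`.** If `Φ : A ≃ B × B` puts `ρ σ`
in the form `(χ(σ) e(σ); 0 δ(σ))`, `B[c]` is finite for every `c ≠ 0`, and `χ(σ₁) − 1 ≠ 0`, `δ(σ₁) − 1 ≠ 0`, then `{a | ρ σ₁ a = a}` is
finite: `(δ(σ₁) − 1)y = 0` leaves finitely many `y`, and for each the `x` with `(χ(σ₁) − 1)x = −e(σ₁)y` form a translate of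
`B[χ(σ₁) − 1]`. [cite: JetchevSkinnerWan2017, §3.3, Case 3(b) (arXiv:1512.06894 p. 13)] [cite: Greenberg1989, §1 p. 98] -/
theorem finite_fixed_of_apply_sub_one_ne_zero {𝒪 : Type*} [CommRing 𝒪] {A : Type*} [AddCommGroup A] [Module 𝒪 A]
    {B : Type*} [AddCommGroup B] [Module 𝒪 B] {ι : Type*} {F : Type*} [FunLike F ι (A →ₗ[𝒪] A)] (ρ : F)
    (Φ : A ≃ₗ[𝒪] B × B) (χ e δ : ι → 𝒪)
    (hΦ : ∀ σ a, Φ (ρ σ a) = (χ σ • (Φ a).1 + e σ • (Φ a).2, δ σ • (Φ a).2))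
    (hB : ∀ c : 𝒪, c ≠ 0 → {y : B | c • y = 0}.Finite)
    (σ₁ : ι) (hχ : χ σ₁ - 1 ≠ 0) (hδ : δ σ₁ - 1 ≠ 0) :
    {a : A | ρ σ₁ a = a}.Finite := by
  -- the fixed vectors of the model
  have hS : {b : B × B | (χ σ₁ • b.1 + e σ₁ • b.2, δ σ₁ • b.2) = b}.Finite := by
    have hsub : {b : B × B | (χ σ₁ • b.1 + e σ₁ • b.2, δ σ₁ • b.2) = b} ⊆
        ⋃ y ∈ {y : B | (δ σ₁ - 1) • y = 0}, {b : B × B | b.2 = y ∧ (χ σ₁ - 1) • b.1 = -(e σ₁ • y)} := by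
      intro b hb
      have h1 : χ σ₁ • b.1 + e σ₁ • b.2 = b.1 := congrArg Prod.fst hb
      have h2 : δ σ₁ • b.2 = b.2 := congrArg Prod.snd hb
      simp only [Set.mem_iUnion, Set.mem_setOf_eq, exists_prop]
      refine ⟨b.2, by rw [sub_smul, one_smul, h2, sub_self], rfl, ?_⟩
      rw [sub_smul, one_smul]
      have : χ σ₁ • b.1 = b.1 - e σ₁ • b.2 := eq_sub_of_add_eq h1
      rw [this]; abel
    refine (Set.Finite.biUnion (hB _ hδ) fun y _ ↦ ?_).subset hsub
    by_cases hex : ∃ x₀ : B, (χ σ₁ - 1) • x₀ = -(e σ₁ • y)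
    · obtain ⟨x₀, hx₀⟩ := hex
      refine ((hB _ hχ).image fun t ↦ ((x₀ + t, y) : B × B)).subset ?_
      rintro b ⟨hb2, hb1⟩
      refine ⟨b.1 - x₀, ?_, ?_⟩
      · change (χ σ₁ - 1) • (b.1 - x₀) = 0
        rw [smul_sub, hb1, hx₀, sub_self]
      · change (x₀ + (b.1 - x₀), y) = b
        rw [add_sub_cancel, ← hb2]
    · exact Set.finite_empty.subset fun b hb ↦ (hex ⟨b.1, hb.2⟩).elim
  refine Set.Finite.of_finite_image (f := Φ) (hS.subset ?_) Φ.injective.injOn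
  rintro _ ⟨a, ha, rfl⟩
  change (χ σ₁ • (Φ a).1 + e σ₁ • (Φ a).2, δ σ₁ • (Φ a).2) = Φ a
  have ha' : ρ σ₁ a = a := ha
  rw [← hΦ σ₁ a, ha']

/-! ## §2 `p`-adic exponents: `a_m → 0` in `ℤ_p` ⟹ `u^{a_m} → 1` for a principal unit; unramified characters on `ker ν` -/

section Units

variable {L : Type*} [NormedField L] [IsUltrametricDist L] {p : ℕ} [Fact p.Prime]

omit [Fact p.Prime] in
/-- `‖u^{p^e} − 1‖ ≤ c^e` for a principal unit `u`, `c = max ‖p‖ ‖u − 1‖`: `u^p − 1 = (u − 1)(p + ∑ (u^i − 1))`.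
[cite: SerreLocalFields1979, Ch. IV §2 Prop. 6 and §3 Prop. 9] -/
theorem norm_pow_prime_pow_sub_one_le {u : L} (hu : ‖u - 1‖ < 1) (e : ℕ) :
    ‖u ^ (p ^ e) - 1‖ ≤ ‖u - 1‖ * (max ‖(p : L)‖ ‖u - 1‖) ^ e := by
  have hu1 : ‖u‖ = 1 := norm_eq_one_of_norm_sub_one_lt_one hu
  set c := max ‖(p : L)‖ ‖u - 1‖ with hc
  induction e with
  | zero => simp
  | succ e ih =>
    set w := u ^ (p ^ e) with hw
    have hw1 : ‖w‖ ≤ 1 := by rw [hw, norm_pow, hu1, one_pow]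
    have hwle : ‖w - 1‖ ≤ ‖u - 1‖ := PadicUnitPowers.norm_pow_sub_one_le hu1.le _
    -- `w^p - 1 = (∑ w^i) (w - 1)` with `‖∑ w^i‖ ≤ c`
    have hgeom : (∑ i ∈ Finset.range p, w ^ i) * (w - 1) = w ^ p - 1 := geom_sum_mul w p
    have hdec : ∑ i ∈ Finset.range p, w ^ i = (p : L) + ∑ i ∈ Finset.range p, (w ^ i - 1) := by
      rw [Finset.sum_sub_distrib, Finset.sum_const, Finset.card_range, nsmul_eq_mul, mul_one]; ring
    have hs : ‖∑ i ∈ Finset.range p, w ^ i‖ ≤ c := by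
      rw [hdec]
      refine (IsUltrametricDist.norm_add_le_max _ _).trans (max_le (le_max_left _ _) ?_)
      refine (IsUltrametricDist.norm_sum_le_of_forall_le_of_nonneg (norm_nonneg (u - 1)) fun i _ ↦ ?_).trans
        (le_max_right _ _)
      exact (PadicUnitPowers.norm_pow_sub_one_le hw1 i).trans hwle
    rw [pow_succ, pow_mul, ← hgeom, norm_mul, pow_succ, ← mul_assoc, mul_comm (‖u - 1‖ * c ^ e) c]
    calc ‖∑ i ∈ Finset.range p, w ^ i‖ * ‖w - 1‖ ≤ c * (‖u - 1‖ * c ^ e) :=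
          mul_le_mul hs ih (norm_nonneg _) (le_trans (norm_nonneg _) hs)
      _ = c * (‖u - 1‖ * c ^ e) := rfl

/-- **Converse exponent estimate: `a_m → 0` in `ℤ_p` ⟹ `u^{a_m} → 1`** for `‖u − 1‖ < 1` in an ultrametric field with `‖p‖ < 1`
(each `p^e` eventually divides `a_m`, and `‖u^{p^e d} − 1‖ ≤ ‖u^{p^e} − 1‖ ≤ c^e`).
[cite: SerreLocalFields1979, Ch. IV §3 Prop. 9 (the principal units as a `ℤ_p`-module)] -/
theorem tendsto_pow_of_tendsto_natCast_padicInt_zero (hpL : ‖(p : L)‖ < 1) {u : L} (hu : ‖u - 1‖ < 1)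
    {a : ℕ → ℕ} (ha : Tendsto (fun m ↦ ((a m : ℕ) : ℤ_[p])) atTop (𝓝 0)) :
    Tendsto (fun m ↦ u ^ (a m)) atTop (𝓝 1) := by
  have hp : p.Prime := Fact.out
  have hu1 : ‖u‖ = 1 := norm_eq_one_of_norm_sub_one_lt_one hu
  set c := max ‖(p : L)‖ ‖u - 1‖ with hc
  have hc0 : 0 ≤ c := le_max_of_le_left (norm_nonneg _)
  have hc1 : c < 1 := max_lt hpL hu
  -- eventually `p^e ∣ a m`
  have hdiv : ∀ e : ℕ, ∀ᶠ m in atTop, p ^ e ∣ a m := by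
    intro e
    have hpos : (0 : ℝ) < (p : ℝ) ^ (-(e : ℤ)) := zpow_pos (Nat.cast_pos.mpr hp.pos) _
    have hev := (Metric.tendsto_atTop.mp ha) _ hpos
    obtain ⟨M, hM⟩ := hev
    filter_upwards [eventually_ge_atTop M] with m hm
    have h := (hM m hm).le
    rw [dist_zero_right, ← Int.cast_natCast, PadicInt.norm_int_le_pow_iff_dvd] at h
    exact_mod_cast h
  rw [Metric.tendsto_atTop]
  intro ε hε
  obtain ⟨e, he⟩ := exists_pow_lt_of_lt_one hε hc1
  obtain ⟨M, hM⟩ := (hdiv e).exists_forall_of_atTop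
  refine ⟨M, fun m hm ↦ ?_⟩
  obtain ⟨d, hd⟩ := hM m hm
  rw [dist_eq_norm, hd, pow_mul]
  calc ‖(u ^ p ^ e) ^ d - 1‖ ≤ ‖u ^ p ^ e - 1‖ :=
        PadicUnitPowers.norm_pow_sub_one_le (by rw [norm_pow, hu1, one_pow]) d
    _ ≤ ‖u - 1‖ * c ^ e := norm_pow_prime_pow_sub_one_le hu e
    _ ≤ 1 * c ^ e := mul_le_mul_of_nonneg_right hu.le (pow_nonneg hc0 e)
    _ < ε := by rw [one_mul]; exact he

end Units

/-- **An unramified character is torsion on the kernel of a non-degenerate unramified `ℤ_p`-character.** For a non-archimedean local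
field `F`, an arithmetic Frobenius `σ₀`, `ν : Γ_F → ℤ_p` and `δ : Γ_F → L` continuous and trivial on inertia, with `ν(σ₀) ≠ 0` and
`‖δ(σ₀)^N − 1‖ < 1` (`L` ultrametric, `‖p‖ < 1`): `ν(σ) = 0 ⟹ δ(σ)^N = 1`. By density of `⟨σ₀⟩·I_F`, `σ = σ₀^{a_m}u_m` with `u_m`
near `I_F`; `0 = ν(σ) = a_m ν(σ₀) + ν(u_m)` forces `a_m → 0` in `ℤ_p`, so `δ(σ)^N = (δ(σ₀)^N)^{a_m}·δ(u_m)^N → 1`.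
[cite: SerreLocalFields1979, Ch. IV §4 Cor. 2 to Prop. 16] -/
theorem pow_eq_one_of_unramified_of_apply_eq_one {F : Type*} [Field F] [ValuativeRel F] [TopologicalSpace F]
    [IsNonarchimedeanLocalField F] {p : ℕ} [Fact p.Prime]
    {σ₀ : absoluteGaloisGroup F} (hσ₀ : IsAbsArithFrob σ₀)
    (ν : absoluteGaloisGroup F →ₜ* Multiplicative ℤ_[p]) (hνI : ∀ τ ∈ absInertia F, ν τ = 1) (hν₀ : ν σ₀ ≠ 1)
    {L : Type*} [NormedField L] [IsUltrametricDist L] (hpL : ‖(p : L)‖ < 1)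
    (δ : absoluteGaloisGroup F →* L) (hδc : Continuous δ) (hδI : ∀ τ ∈ absInertia F, δ τ = 1)
    {N : ℕ} (hN : ‖δ σ₀ ^ N - 1‖ < 1)
    {σ : absoluteGaloisGroup F} (hσ : ν σ = 1) : δ σ ^ N = 1 := by
  -- shrinking open neighbourhoods of the inertia group
  let ε : ℕ → ℝ := fun m ↦ 1 / ((m : ℝ) + 1)
  have hε : ∀ m, 0 < ε m := fun m ↦ by positivity
  have hε0 : Tendsto ε atTop (𝓝 0) := tendsto_one_div_add_atTop_nhds_zero_nat
  let U : ℕ → Set (absoluteGaloisGroup F) := fun m ↦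
    {τ | ‖(ν τ).toAdd‖ < ε m ∧ ‖δ τ ^ N - 1‖ < ε m}
  have hνc : Continuous fun τ ↦ (ν τ).toAdd := continuous_toAdd.comp (map_continuous ν)
  have hUo : ∀ m, IsOpen (U m) := fun m ↦
    (isOpen_lt (continuous_norm.comp hνc) continuous_const).inter
      (isOpen_lt (continuous_norm.comp (((hδc.pow N)).sub continuous_const)) continuous_const)
  have hUI : ∀ m, (absInertia F : Set (absoluteGaloisGroup F)) ⊆ U m := fun m τ hτ ↦ by
    refine ⟨?_, ?_⟩
    · show ‖(ν τ).toAdd‖ < ε m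
      rw [hνI τ hτ, toAdd_one, norm_zero]; exact hε m
    · show ‖δ τ ^ N - 1‖ < ε m
      rw [hδI τ hτ, one_pow, sub_self, norm_zero]; exact hε m
  -- density: `σ = σ₀^{a m} · u m` with `u m ∈ U m`
  have hdens : ∀ m, ∃ a : ℕ, (σ₀ ^ a)⁻¹ * σ ∈ U m := fun m ↦ by
    obtain ⟨a, -, ha⟩ := exists_forall_smul_eq_pow_and_mem hσ₀ σ ∅ (by simp) (hUo m) (hUI m)
    exact ⟨a, ha⟩
  choose a ha using hdens
  have hσeq : ∀ m, σ = σ₀ ^ a m * ((σ₀ ^ a m)⁻¹ * σ) := fun m ↦ by rw [mul_inv_cancel_left]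
  -- `ν`: `0 = a m • ν σ₀ + ν (u m)`, `ν (u m) → 0`, hence `a m → 0` in `ℤ_p`
  have hνeq : ∀ m, ((a m : ℕ) : ℤ_[p]) * (ν σ₀).toAdd = -(ν ((σ₀ ^ a m)⁻¹ * σ)).toAdd := by
    intro m
    have h : ν σ = ν (σ₀ ^ a m) * ν ((σ₀ ^ a m)⁻¹ * σ) := by rw [← map_mul, mul_inv_cancel_left]
    rw [map_pow, hσ] at h
    have h' := congrArg Multiplicative.toAdd h
    rw [toAdd_one, toAdd_mul, toAdd_pow, nsmul_eq_mul] at h'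
    linear_combination -h'
  have hνu : Tendsto (fun m ↦ (ν ((σ₀ ^ a m)⁻¹ * σ)).toAdd) atTop (𝓝 0) := by
    rw [tendsto_zero_iff_norm_tendsto_zero]
    exact squeeze_zero (fun m ↦ norm_nonneg _) (fun m ↦ (ha m).1.le) hε0
  have hν₀' : (ν σ₀).toAdd ≠ 0 := fun h ↦ hν₀ (Multiplicative.toAdd.injective (by rw [h, toAdd_one]))
  have hat : Tendsto (fun m ↦ ((a m : ℕ) : ℤ_[p])) atTop (𝓝 0) := by
    have h1 : Tendsto (fun m ↦ ((a m : ℕ) : ℤ_[p]) * (ν σ₀).toAdd) atTop (𝓝 0) := by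
      have h := hνu.neg
      rw [neg_zero] at h
      exact h.congr fun m ↦ (hνeq m).symm
    rw [tendsto_zero_iff_norm_tendsto_zero] at h1 ⊢
    have h2 : Tendsto (fun m ↦ ‖((a m : ℕ) : ℤ_[p]) * (ν σ₀).toAdd‖ * ‖(ν σ₀).toAdd‖⁻¹) atTop (𝓝 0) := by
      have := h1.mul_const ‖(ν σ₀).toAdd‖⁻¹
      rwa [zero_mul] at this
    refine h2.congr fun m ↦ ?_
    rw [norm_mul, mul_assoc, mul_inv_cancel₀ (norm_ne_zero_iff.mpr hν₀'), mul_one]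
  -- `δ`: `δ σ ^ N = (δ σ₀ ^ N) ^ (a m) * δ (u m) ^ N → 1 · 1`
  have hδeq : ∀ m, δ σ ^ N = (δ σ₀ ^ N) ^ (a m) * δ ((σ₀ ^ a m)⁻¹ * σ) ^ N := by
    intro m
    conv_lhs => rw [hσeq m]
    rw [map_mul, map_pow, mul_pow, ← pow_mul, ← pow_mul, mul_comm N (a m)]
  have hδu : Tendsto (fun m ↦ δ ((σ₀ ^ a m)⁻¹ * σ) ^ N) atTop (𝓝 1) := by
    rw [tendsto_iff_norm_sub_tendsto_zero]
    exact squeeze_zero (fun m ↦ norm_nonneg _) (fun m ↦ (ha m).2.le) hε0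
  have hmain : Tendsto (fun m ↦ (δ σ₀ ^ N) ^ (a m) * δ ((σ₀ ^ a m)⁻¹ * σ) ^ N) atTop (𝓝 1) := by
    have h := (tendsto_pow_of_tendsto_natCast_padicInt_zero hpL hN hat).mul hδu
    rwa [one_mul] at h
  exact tendsto_nhds_unique (tendsto_const_nhds.congr fun m ↦ hδeq m) hmain

/-- **An unramified character trivial at an arithmetic Frobenius is trivial** (density of `⟨σ₀⟩·I_F`).
[cite: SerreLocalFields1979, Ch. IV §4 Cor. 2 to Prop. 16] -/
theorem unramified_apply_eq_one_of_apply_frob_eq_one {F : Type*} [Field F] [ValuativeRel F] [TopologicalSpace F]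
    [IsNonarchimedeanLocalField F] {p : ℕ} [Fact p.Prime]
    {σ₀ : absoluteGaloisGroup F} (hσ₀ : IsAbsArithFrob σ₀)
    (ν : absoluteGaloisGroup F →ₜ* Multiplicative ℤ_[p]) (hνI : ∀ τ ∈ absInertia F, ν τ = 1) (hν₀ : ν σ₀ = 1)
    (σ : absoluteGaloisGroup F) : ν σ = 1 := by
  have hνc : Continuous fun τ ↦ (ν τ).toAdd := continuous_toAdd.comp (map_continuous ν)
  have key : ∀ ε : ℝ, 0 < ε → ‖(ν σ).toAdd‖ < ε := by
    intro ε hε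
    have hUo : IsOpen {τ : absoluteGaloisGroup F | ‖(ν τ).toAdd‖ < ε} :=
      isOpen_lt (continuous_norm.comp hνc) continuous_const
    have hUI : (absInertia F : Set (absoluteGaloisGroup F)) ⊆ {τ | ‖(ν τ).toAdd‖ < ε} := fun τ hτ ↦ by
      show ‖(ν τ).toAdd‖ < ε
      rw [hνI τ hτ, toAdd_one, norm_zero]; exact hε
    obtain ⟨a, -, ha⟩ := exists_forall_smul_eq_pow_and_mem hσ₀ σ ∅ (by simp) hUo hUI
    have h : ν σ = ν ((σ₀ ^ a)⁻¹ * σ) := by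
      rw [map_mul, map_inv, map_pow, hν₀, one_pow, inv_one, one_mul]
    rw [h]; exact ha
  have h0 : (ν σ).toAdd = 0 := by
    by_contra hne
    exact lt_irrefl _ (key _ (norm_pos_iff.mpr hne))
  exact Multiplicative.toAdd.injective (by rw [h0, toAdd_one])

/-! ## §3 Two-coordinate exponent separation -/

/-- **A continuous character torsion on `P = ker κ₁ ∩ ker κ₂`, with an exponent-separating value at some `σ_K ∈ ker κ₂ ∖ ker κ₁`, is
`≠ 1` at every `σ₁ ∈ ker κ₂ ∖ ker κ₁`.** `Θ : Γ_F →* L` continuous (`Γ_F` the absolute Galois group of a non-archimedean local field,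
compact), `κ₁, κ₂ : Γ_F →ₜ* ℤ_p`; `Θ(σ)^N = 1` whenever `κ₁ σ = κ₂ σ = 0`; `κ₂ σ_K = 0 ≠ κ₁ σ_K` and `θ = Θ(σ_K)⁻¹` separates exponents
(`θ^{a_m} → 1 ⟹ a_m → 0` in `ℤ_p`). If `Θ(σ₁) = 1` with `κ₂ σ₁ = 0 ≠ κ₁ σ₁`: write `p^v κ₁(σ₁) = λ κ₁(σ_K)` (`λ ∈ ℤ_p ∖ 0`), take naturals
`n_m → λ`; `τ_m = σ₁^{p^v} σ_K^{−n_m}` has `κ₂ = 0`, `κ₁ → 0`, `Θ(τ_m) = θ^{n_m}`; a cluster point `τ_∞` (compactness) lies in `P`, so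
`θ^{N n_m}` clusters at `1`, and along a subsequence `N n_m → 0` in `ℤ_p` — contradicting `n_m → λ ≠ 0`.
[cite: SerreLocalFields1979, Ch. IV §3 Prop. 9] [cite: JetchevSkinnerWan2017, §3.3 Case 3(b) (arXiv:1512.06894 p. 13)] -/
theorem apply_ne_one_of_pow_eq_one_of_ker {F : Type} [Field F] [ValuativeRel F] [TopologicalSpace F]
    [IsNonarchimedeanLocalField F] {p : ℕ} [Fact p.Prime] {L : Type*} [NormedField L]
    (Θ : absoluteGaloisGroup F →* L) (hΘc : Continuous Θ)
    (κ₁ κ₂ : absoluteGaloisGroup F →ₜ* Multiplicative ℤ_[p])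
    {N : ℕ} (hN : 0 < N) (hP : ∀ σ, κ₁ σ = 1 → κ₂ σ = 1 → Θ σ ^ N = 1)
    {σK : absoluteGaloisGroup F} (hK₂ : κ₂ σK = 1) (hK₁ : κ₁ σK ≠ 1)
    (hsep : ∀ a : ℕ → ℕ, Tendsto (fun m ↦ (Θ σK)⁻¹ ^ (a m)) atTop (𝓝 1) →
      Tendsto (fun m ↦ ((a m : ℕ) : ℤ_[p])) atTop (𝓝 0))
    {σ₁ : absoluteGaloisGroup F} (h₁ : κ₂ σ₁ = 1) (h₁' : κ₁ σ₁ ≠ 1) : Θ σ₁ ≠ 1 := by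
  intro hΘ1
  have hp : p.Prime := Fact.out
  haveI : CompactSpace (absoluteGaloisGroup F) := absoluteGaloisGroup_compactSpace F
  -- units: `Θ σ ≠ 0`, `Θ σ⁻¹ = (Θ σ)⁻¹`
  have hΘinv : ∀ σ, Θ σ⁻¹ = (Θ σ)⁻¹ := fun σ ↦
    eq_inv_of_mul_eq_one_left (by rw [← map_mul, inv_mul_cancel, map_one])
  -- the two `κ₁`-coordinates
  set tK := (κ₁ σK).toAdd with htK
  set t₁ := (κ₁ σ₁).toAdd with ht₁
  have htK0 : tK ≠ 0 := fun h ↦ hK₁ (Multiplicative.toAdd.injective (by rw [← htK, h, toAdd_one]))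
  have ht₁0 : t₁ ≠ 0 := fun h ↦ h₁' (Multiplicative.toAdd.injective (by rw [← ht₁, h, toAdd_one]))
  -- `tK = u p^v`, `λ := t₁ u⁻¹`, so that `λ tK = t₁ p^v`
  set v := tK.valuation with hv
  set u := PadicInt.unitCoeff htK0 with hu
  have htKu : tK = (u : ℤ_[p]) * (p : ℤ_[p]) ^ v := PadicInt.unitCoeff_spec htK0
  set lam : ℤ_[p] := t₁ * ((u⁻¹ : ℤ_[p]ˣ) : ℤ_[p]) with hlam
  have hlamK : lam * tK = t₁ * (p : ℤ_[p]) ^ v := by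
    rw [hlam, htKu, mul_assoc, ← mul_assoc ((u⁻¹ : ℤ_[p]ˣ) : ℤ_[p]), Units.inv_mul, one_mul]
  have hlam0 : lam ≠ 0 := mul_ne_zero ht₁0 (Units.ne_zero _)
  -- naturals `n m → λ`
  let n : ℕ → ℕ := fun m ↦ PadicInt.appr lam m
  have hn : Tendsto (fun m ↦ ((n m : ℕ) : ℤ_[p])) atTop (𝓝 lam) := by
    rw [Metric.tendsto_atTop]
    intro ε hε
    obtain ⟨e, he⟩ := PadicInt.exists_pow_neg_lt p hε
    refine ⟨e, fun m hm ↦ lt_of_le_of_lt ?_ he⟩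
    rw [dist_eq_norm, ← norm_neg, neg_sub]
    have hmem : lam - (n m : ℤ_[p]) ∈ (Ideal.span {(p : ℤ_[p]) ^ m} : Ideal ℤ_[p]) := PadicInt.appr_spec m lam
    have h := (PadicInt.norm_le_pow_iff_mem_span_pow _ m).mpr hmem
    exact h.trans (zpow_le_zpow_right₀ (by exact_mod_cast hp.one_lt.le) (by omega))
  -- the approximating elements `τ m = σ₁^{p^v} σK^{-n m}`
  let τ : ℕ → absoluteGaloisGroup F := fun m ↦ σ₁ ^ (p ^ v) * (σK ^ (n m))⁻¹
  have hτ₂ : ∀ m, κ₂ (τ m) = 1 := fun m ↦ by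
    change κ₂ (σ₁ ^ (p ^ v) * (σK ^ (n m))⁻¹) = 1
    rw [map_mul, map_pow, map_inv, map_pow, h₁, hK₂, one_pow, one_pow, inv_one, mul_one]
  have hτ₁ : ∀ m, (κ₁ (τ m)).toAdd = (lam - (n m : ℤ_[p])) * tK := fun m ↦ by
    change (κ₁ (σ₁ ^ (p ^ v) * (σK ^ (n m))⁻¹)).toAdd = _
    rw [map_mul, map_pow, map_inv, map_pow, toAdd_mul, toAdd_inv, toAdd_pow, toAdd_pow, ← ht₁, ← htK,
      nsmul_eq_mul, nsmul_eq_mul, sub_mul, hlamK]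
    push_cast
    ring
  have hτ₁lim : Tendsto (fun m ↦ (κ₁ (τ m)).toAdd) atTop (𝓝 0) := by
    have h : Tendsto (fun m ↦ (lam - (n m : ℤ_[p])) * tK) atTop (𝓝 ((lam - lam) * tK)) :=
      (tendsto_const_nhds.sub hn).mul_const tK
    rw [sub_self, zero_mul] at h
    exact h.congr fun m ↦ (hτ₁ m).symm
  have hΘτ : ∀ m, Θ (τ m) = (Θ σK)⁻¹ ^ (n m) := fun m ↦ by
    change Θ (σ₁ ^ (p ^ v) * (σK ^ (n m))⁻¹) = _
    rw [map_mul, map_pow, hΘ1, one_pow, one_mul, hΘinv, map_pow, inv_pow]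
  -- a cluster point `τ∞` of `τ`; it lies in `P`
  obtain ⟨τinf, hcl⟩ := exists_clusterPt_of_compactSpace (Filter.map τ atTop)
  have hinf₁ : κ₁ τinf = 1 := by
    have hg : Continuous fun σ ↦ (κ₁ σ).toAdd := continuous_toAdd.comp (map_continuous κ₁)
    have h1 : ClusterPt ((κ₁ τinf).toAdd) (Filter.map (fun σ ↦ (κ₁ σ).toAdd) (Filter.map τ atTop)) :=
      hcl.map hg.continuousAt Filter.tendsto_map
    rw [Filter.map_map] at h1
    have h2 : ClusterPt ((κ₁ τinf).toAdd) (𝓝 (0 : ℤ_[p])) := h1.mono hτ₁lim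
    exact Multiplicative.toAdd.injective ((eq_of_nhds_neBot h2).trans toAdd_one.symm)
  have hinf₂ : κ₂ τinf = 1 := by
    have h1 : ClusterPt (κ₂ τinf) (Filter.map (fun σ ↦ κ₂ σ) (Filter.map τ atTop)) :=
      hcl.map (map_continuous κ₂).continuousAt Filter.tendsto_map
    rw [Filter.map_map] at h1
    have hconst : Tendsto ((fun σ ↦ κ₂ σ) ∘ τ) atTop (𝓝 1) :=
      tendsto_const_nhds.congr fun m ↦ (hτ₂ m).symm
    exact eq_of_nhds_neBot (h1.mono hconst)
  have hPinf : Θ τinf ^ N = 1 := hP τinf hinf₁ hinf₂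
  -- `Θ^N ∘ τ` clusters at `Θ(τ∞)^N = 1`
  have hclΘ : MapClusterPt (1 : L) atTop (fun m ↦ Θ (τ m) ^ N) := by
    have hg : Continuous fun σ ↦ Θ σ ^ N := hΘc.pow N
    have h1 : ClusterPt (Θ τinf ^ N) (Filter.map (fun σ ↦ Θ σ ^ N) (Filter.map τ atTop)) :=
      hcl.map hg.continuousAt Filter.tendsto_map
    rw [Filter.map_map, hPinf] at h1
    exact h1
  obtain ⟨φ, hφ, hφlim⟩ := hclΘ.tendsto_subseq
  -- along `φ`: `θ^{n (φ j) N} → 1`, hence `n (φ j) N → 0` in `ℤ_p`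
  have hlim1 : Tendsto (fun j ↦ (Θ σK)⁻¹ ^ (n (φ j) * N)) atTop (𝓝 1) := by
    refine hφlim.congr fun j ↦ ?_
    change Θ (τ (φ j)) ^ N = _
    rw [hΘτ, ← pow_mul]
  have hzero := hsep (fun j ↦ n (φ j) * N) hlim1
  -- but `n (φ j) N → λ N ≠ 0`
  have hlam' : Tendsto (fun j ↦ (((n (φ j) * N : ℕ)) : ℤ_[p])) atTop (𝓝 (lam * N)) := by
    have h := (hn.comp hφ.tendsto_atTop).mul_const (N : ℤ_[p])
    refine h.congr fun j ↦ ?_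
    simp only [Function.comp_apply, Nat.cast_mul]
  have hNe : (lam * N : ℤ_[p]) ≠ 0 := mul_ne_zero hlam0 (Nat.cast_ne_zero.mpr hN.ne')
  exact hNe (tendsto_nhds_unique hlam' hzero)

end Summit.BirchSwinnertonDyer.BirchSwinnertonDyer.Theorems.ErratumThm23TwoVariable.FixTwist

end
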